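import Literature.AlgebraicGeometry.Motives.HodgeThetaSubalgebraUnitaryEightNineCore
import Literature.AlgebraicGeometry.Motives.HodgeThetaSubalgebraUnitarySixSevenCoreAll
import Literature.AlgebraicGeometry.Motives.HodgeThetaSubalgebraUnitaryFourOddCore
import HarnessLib

/-!
# The `Θ`-subalgebra theorem for unitary multiplicities `(a, 17)`, EVERY `1 ≤ a ≤ 16` — complex–Hermitian,
# classification-free, by the double-Levi route alone (Ribet 1983 Thm. 3, Lie step; 29-folds `(12, 17)`, 31-folds `(14, 17)`)

Family `hodge`, layer `Literature/AlgebraicGeometry/Motives` (pure linear algebra over `ℂ`; no geometry). Research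
context: cell `pub-hodge-ring2` (HONEST FRAMING: research route conditional on HC_CM; not a corollary; Q11.4-sentence-2
already refuted in dim ≥ 3), Literature lane gen 85, programme R71. UNCONDITIONAL; theorems only, no definition, no
named fact (D-0026), no `sorry`.

THE OBSERVATION. For a PRIME `b` every rank `ρ ∈ [1, b − 1]` is prime to `b`, so the larger-side Levi type `(ρ | b − ρ)`
of ANY raising operator of rank `ρ` is a coprime pair with `ρ + (b − ρ) = b`. By `UnitaryDoubleLevi.eq_top_of_raise_of_core`
(`HodgeThetaSubalgebraUnitaryEightNineCore` §1) a single raising operator of rank `≥ 2`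
(`UnitaryThreeCoprime.exists_raise_rank_ge_two`) then forces `𝔊 = End(W)` as soon as all the cores `(ρ | b − ρ)`,
`2 ≤ ρ ≤ a`, are in the tree — NO ladder, NO maximal rank, NO Euclid descent. For `b = 17` the sixteen cores are
`(2|15)`, `(3|14)`, `(4|13)`, `(5|12)`, `(6|11)`, `(7|10)`, `(8|9)`, `(9|8)`, `(10|7)`, `(11|6)`, `(12|5)`, `(13|4)`, `(14|3)`,
`(15|2)`, `(16|1)`: the tree's `UnitaryTwoOdd`, `UnitaryThreeCoprime`, `UnitaryFourOdd`, `UnitaryFive/Six/Seven…of_smul` (and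
mirrors), `UnitaryThreeCoprime.eq_top_of_finrank_eq_one`, and THIS generation's `UnitaryEightNine.eq_top`/`eq_top'` — the
two that were missing (lit-g84: `(8|17)`, `(9|17)`, `(10|17)`, `(12|17)`, `(14|17)`, `(15|17)`, `(16|17)` «NOT reached»).

* **`UnitarySeventeen.eq_top_of_smul`** — `dim Q = 17`, `1 ≤ dim P ≤ 16`, Hermitian form `ℂ`-homogeneous in the first
  slot (needed by the `(5|·)`, `(6|·)`, `(7|·)` cores) ⟹ `𝔊 = End(W)`; **`UnitarySeventeen.eq_top_of_smul'`** — the mirror.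

CONSEQUENCE (sequel `HodgeTheory/RibetTypeSeventeenPartnerPowersHodgeClasses`): Ribet's Thm. 3 at `(a, 17)` for every
`a ≤ 16` — in particular the prime-dimension census cells `29 = 12 + 17` and `31 = 14 + 17` close.

## References
* [Ribet1983] K. A. Ribet, *Hodge classes on certain types of abelian varieties*, Amer. J. Math. 105 (1983), Thm. 3.
* [Gordon1997] B. B. Gordon, *A survey of the Hodge conjecture for abelian varieties*, Thm. 6.3 (3), pp. 18–19.
* [Deligne1982HodgeCycles] P. Deligne, *Hodge cycles on abelian varieties*, LNM 900 (1982), I §3 Prop. 3.4, 3.6.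
-/

noncomputable section

open Module

namespace Literature.AlgebraicGeometry.Motives

namespace HodgeStructure

universe u

variable {W : Type u} [AddCommGroup W] [Module ℂ W]

/-- **THE `Θ`-SUBALGEBRA THEOREM FOR UNITARY MULTIPLICITIES `(a, 17)`, `1 ≤ a ≤ 16`** (Hermitian form `ℂ`-homogeneous
in the first slot). One raising operator of rank `ρ ≥ 2` and the core `(ρ | 17 − ρ)` suffice
(`UnitaryDoubleLevi.eq_top_of_raise_of_core`); `a ≤ 2` is the tree's `(1|m)`, `(2|odd)`. [cite: Ribet1983, Thm. 3]
[cite: Gordon1997, Thm. 6.3 (3)] [cite: Deligne1982HodgeCycles, I §3 Prop. 3.6] -/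
theorem UnitarySeventeen.eq_top_of_smul [FiniteDimensional ℂ W] {𝔊 : Submodule ℂ (Module.End ℂ W)}
    (hbr : ∀ Y ∈ 𝔊, ∀ Z ∈ 𝔊, Y * Z - Z * Y ∈ 𝔊)
    (hirr : ∀ U : Submodule ℂ W, (∀ A ∈ 𝔊, ∀ u ∈ U, A u ∈ U) → U = ⊥ ∨ U = ⊤)
    {Θ : Module.End ℂ W} (hΘ : Θ ∈ 𝔊) (hΘΘ : Θ * Θ = 1)
    {P Q : Submodule ℂ W} (hP : ∀ x, x ∈ P ↔ Θ x = x) (hQ : ∀ x, x ∈ Q ↔ Θ x = -x)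
    (hP1 : 1 ≤ Module.finrank ℂ P) (hP16 : Module.finrank ℂ P ≤ 16) (hQ17 : Module.finrank ℂ Q = 17)
    {s : W → W → ℂ} (hadd : ∀ x y z, s (x + y) z = s x z + s y z)
    (hsmul : ∀ (c : ℂ) (x y : W), s (c • x) y = c * s x y) (hsymm : ∀ x y, s y x = starRingEnd ℂ (s x y))
    (hPQ : ∀ p ∈ P, ∀ q ∈ Q, s p q = 0) (hdefP : ∀ p ∈ P, s p p = 0 → p = 0) (hdefQ : ∀ q ∈ Q, s q q = 0 → q = 0)
    (hadj : ∀ X ∈ 𝔊, ∃ Y ∈ 𝔊, ∀ x y, s (X x) y = s x (Y y)) : 𝔊 = ⊤ := by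
  classical
  -- `a = 1`, `a = 2`
  by_cases ha1 : Module.finrank ℂ P = 1
  · exact UnitaryThreeCoprime.eq_top_of_finrank_eq_one hbr hirr (Submodule.neg_mem _ hΘ) ((neg_mul_neg Θ Θ).trans hΘΘ)
      (P := Q) (Q := P) (fun x => by rw [hQ, LinearMap.neg_apply, neg_eq_iff_eq_neg])
      (fun x => by rw [hP, LinearMap.neg_apply, neg_inj]) (by omega) ha1
  by_cases ha2 : Module.finrank ℂ P = 2
  · exact UnitaryTwoOdd.eq_top hbr hirr hΘ hΘΘ hP hQ ha2 ⟨8, by omega⟩ hadd hsymm hPQ hdefP hdefQ hadj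
  -- `3 ≤ a ≤ 16`: a raising operator of rank `2 ≤ ρ ≤ 16` and the core `(ρ | 17 − ρ)`
  obtain ⟨B, hB, hΘB, hBΘ, hr2⟩ :=
    UnitaryThreeCoprime.exists_raise_rank_ge_two hbr hirr hΘ hΘΘ hP hQ (by omega) (by omega)
  have hraiseval : ∀ w, B w ∈ P := fun w => (hP _).2 (by rw [← Module.End.mul_apply, hΘB])
  have hr16 : Module.finrank ℂ (LinearMap.range B) ≤ 16 :=
    (Submodule.finrank_mono (by rintro _ ⟨w, rfl⟩; exact hraiseval w)).trans hP16
  have hsU : ∀ U : Submodule ℂ W, ∀ x y z : U, s ((x + y : U) : W) z = s (x : W) z + s (y : W) z :=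
    fun U x y z => by simp only [Submodule.coe_add, hadd]
  have hsmU : ∀ U : Submodule ℂ W, ∀ (c : ℂ) (x y : U), s ((c • x : U) : W) y = c * s (x : W) y :=
    fun U c x y => by simp only [Submodule.coe_smul, hsmul]
  refine UnitaryDoubleLevi.eq_top_of_raise_of_core hbr hirr hΘ hΘΘ hP hQ hadd hsymm hPQ hdefP hdefQ hadj hB hΘB hBΘ
    (by omega) (by omega) (by omega)
    fun U 𝔩 ι P' Q' hbr𝔩 hirr𝔩 hι hιι hP' hQ' hfinP' hfinQ' hP'Q' hdefP' hdefQ' hadj𝔩 => ?_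
  rw [hQ17] at hfinQ'
  obtain ⟨ρ, hρ⟩ : ∃ ρ, Module.finrank ℂ (LinearMap.range B) = ρ := ⟨_, rfl⟩
  rw [hρ] at hfinP' hfinQ' hr2 hr16
  interval_cases ρ
  · exact UnitaryTwoOdd.eq_top hbr𝔩 hirr𝔩 hι hιι hP' hQ' hfinP' ⟨7, by omega⟩ (s := fun x y : U => s (x : W) y)
      (hsU U) (fun x y => hsymm x y) hP'Q' hdefP' hdefQ' hadj𝔩
  · exact UnitaryThreeCoprime.eq_top hbr𝔩 hirr𝔩 hι hιι hP' hQ' hfinP' (by omega) (s := fun x y : U => s (x : W) y)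
      (hsU U) (fun x y => hsymm x y) hP'Q' hdefP' hdefQ' hadj𝔩
  · exact UnitaryFourOdd.eq_top hbr𝔩 hirr𝔩 hι hιι hP' hQ' hfinP' ⟨6, by omega⟩ (s := fun x y : U => s (x : W) y)
      (hsU U) (fun x y => hsymm x y) hP'Q' hdefP' hdefQ' hadj𝔩
  · exact UnitaryFive.eq_top_of_smul hbr𝔩 hirr𝔩 hι hιι hP' hQ' hfinP' (by omega) (s := fun x y : U => s (x : W) y)
      (hsU U) (hsmU U) (fun x y => hsymm x y) hP'Q' hdefP' hdefQ' hadj𝔩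
  · exact UnitarySix.eq_top_of_smul hbr𝔩 hirr𝔩 hι hιι hP' hQ' hfinP' ⟨5, by omega⟩ (by omega)
      (s := fun x y : U => s (x : W) y) (hsU U) (hsmU U) (fun x y => hsymm x y) hP'Q' hdefP' hdefQ' hadj𝔩
  · exact UnitarySeven.eq_top_of_smul hbr𝔩 hirr𝔩 hι hιι hP' hQ' hfinP' (by omega) (s := fun x y : U => s (x : W) y)
      (hsU U) (hsmU U) (fun x y => hsymm x y) hP'Q' hdefP' hdefQ' hadj𝔩
  · exact UnitaryEightNine.eq_top hbr𝔩 hirr𝔩 hι hιι hP' hQ' hfinP' (by omega) (s := fun x y : U => s (x : W) y)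
      (hsU U) (fun x y => hsymm x y) hP'Q' hdefP' hdefQ' hadj𝔩
  · exact UnitaryEightNine.eq_top' hbr𝔩 hirr𝔩 hι hιι hP' hQ' hfinP' (by omega) (s := fun x y : U => s (x : W) y)
      (hsU U) (fun x y => hsymm x y) hP'Q' hdefP' hdefQ' hadj𝔩
  · exact UnitarySeven.eq_top_of_smul' hbr𝔩 hirr𝔩 hι hιι hP' hQ' (by omega) (by omega)
      (s := fun x y : U => s (x : W) y) (hsU U) (hsmU U) (fun x y => hsymm x y) hP'Q' hdefP' hdefQ' hadj𝔩
  · exact UnitarySix.eq_top_of_smul' hbr𝔩 hirr𝔩 hι hιι hP' hQ' (by rw [hfinP']; exact ⟨5, by norm_num⟩) (by omega)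
      (by omega) (s := fun x y : U => s (x : W) y) (hsU U) (hsmU U) (fun x y => hsymm x y) hP'Q' hdefP' hdefQ' hadj𝔩
  · exact UnitaryFive.eq_top_of_smul' hbr𝔩 hirr𝔩 hι hιι hP' hQ' (by omega) (by omega)
      (s := fun x y : U => s (x : W) y) (hsU U) (hsmU U) (fun x y => hsymm x y) hP'Q' hdefP' hdefQ' hadj𝔩
  · exact UnitaryFourOdd.eq_top' hbr𝔩 hirr𝔩 hι hιι hP' hQ' (by rw [hfinP']; exact ⟨6, by norm_num⟩) (by omega)
      (s := fun x y : U => s (x : W) y) (hsU U) (fun x y => hsymm x y) hP'Q' hdefP' hdefQ' hadj𝔩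
  · exact UnitaryThreeCoprime.eq_top' hbr𝔩 hirr𝔩 hι hιι hP' hQ' (by omega) (by omega)
      (s := fun x y : U => s (x : W) y) (hsU U) (fun x y => hsymm x y) hP'Q' hdefP' hdefQ' hadj𝔩
  · exact UnitaryTwoOdd.eq_top' hbr𝔩 hirr𝔩 hι hιι hP' hQ' (by rw [hfinP']; exact ⟨7, by norm_num⟩) (by omega)
      (s := fun x y : U => s (x : W) y) (hsU U) (fun x y => hsymm x y) hP'Q' hdefP' hdefQ' hadj𝔩
  · exact UnitaryThreeCoprime.eq_top_of_finrank_eq_one hbr𝔩 hirr𝔩 hι hιι hP' hQ' (by omega) (by omega)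

/-- **The mirror `(17, a)`, `1 ≤ a ≤ 16`** (apply `eq_top_of_smul` to `−Θ`). [cite: Ribet1983, Thm. 3] [cite: Gordon1997, Thm. 6.3 (3)] -/
theorem UnitarySeventeen.eq_top_of_smul' [FiniteDimensional ℂ W] {𝔊 : Submodule ℂ (Module.End ℂ W)}
    (hbr : ∀ Y ∈ 𝔊, ∀ Z ∈ 𝔊, Y * Z - Z * Y ∈ 𝔊)
    (hirr : ∀ U : Submodule ℂ W, (∀ A ∈ 𝔊, ∀ u ∈ U, A u ∈ U) → U = ⊥ ∨ U = ⊤)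
    {Θ : Module.End ℂ W} (hΘ : Θ ∈ 𝔊) (hΘΘ : Θ * Θ = 1)
    {P Q : Submodule ℂ W} (hP : ∀ x, x ∈ P ↔ Θ x = x) (hQ : ∀ x, x ∈ Q ↔ Θ x = -x)
    (hP17 : Module.finrank ℂ P = 17) (hQ1 : 1 ≤ Module.finrank ℂ Q) (hQ16 : Module.finrank ℂ Q ≤ 16)
    {s : W → W → ℂ} (hadd : ∀ x y z, s (x + y) z = s x z + s y z)
    (hsmul : ∀ (c : ℂ) (x y : W), s (c • x) y = c * s x y) (hsymm : ∀ x y, s y x = starRingEnd ℂ (s x y))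
    (hPQ : ∀ p ∈ P, ∀ q ∈ Q, s p q = 0) (hdefP : ∀ p ∈ P, s p p = 0 → p = 0) (hdefQ : ∀ q ∈ Q, s q q = 0 → q = 0)
    (hadj : ∀ X ∈ 𝔊, ∃ Y ∈ 𝔊, ∀ x y, s (X x) y = s x (Y y)) : 𝔊 = ⊤ := by
  have hnΘ : -Θ ∈ 𝔊 := Submodule.neg_mem _ hΘ
  have hnΘΘ : (-Θ) * (-Θ) = 1 := by rw [neg_mul_neg, hΘΘ]
  exact UnitarySeventeen.eq_top_of_smul hbr hirr hnΘ hnΘΘ (P := Q) (Q := P)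
    (fun x => by rw [hQ, LinearMap.neg_apply, neg_eq_iff_eq_neg]) (fun x => by rw [hP, LinearMap.neg_apply, neg_inj])
    hQ1 hQ16 hP17 hadd hsmul hsymm (fun p hp q hq => by rw [hsymm, hPQ q hq p hp, map_zero]) hdefQ hdefP hadj

end HodgeStructure

end Literature.AlgebraicGeometry.Motives
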